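import Mathlib
import Summits.Ventures.PercRepro2.Defs
import Summits.Ventures.PercRepro2.Independence
import Summits.Ventures.PercRepro2.Harris
import Summits.Ventures.PercRepro2.Graph
import Summits.Ventures.PercRepro2.Exploration
import Summits.Ventures.PercRepro2.Events
import Summits.Ventures.PercRepro2.Induced
import Summits.Ventures.PercRepro2.BHK
import Summits.Ventures.PercRepro2.BHKEvents
import Summits.Ventures.PercRepro2.OneEdge
import Summits.Ventures.PercRepro2.RBRoot
import Summits.Ventures.PercRepro2.RBRootEdge
import Summits.Ventures.PercRepro2.RBRootEdgePin
import Summits.Ventures.PercRepro2.RBRootEdgeMain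
import Summits.Ventures.PercRepro2.RBRootIsolated
import Summits.Ventures.PercRepro2.RBTwoMarkers
import Summits.Ventures.PercRepro2.RBDefs
import Summits.Ventures.PercRepro2.RBClubDefs
import Summits.Ventures.PercRepro2.RBClubRoot
import Summits.Ventures.PercRepro2.RBClubPoly
import Summits.Ventures.PercRepro2.RBClubTwoMarkers

/-!
# The coarse form at a PENDANT third vertex: the refinement loss (blind cell PercRepro2, mine-a g8;
MINE-A.md §50 (d), proofs/MINEA-CLUB.md §7)

Let the only edge of nonzero weight at `w` be `f = {w, u}` (`u ≠ w`, `w ∉ {s, t, b, o}`). Writing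
`clubVal(w) = P(Q ∩ M ∩ bL ∩ oL) + P(Q ∩ Mᶜ ∩ bL) P(Q ∩ Mᶜ ∩ oL) / P(Q ∩ Mᶜ) − P(Q ∩ bL) P(Q ∩ oL) / P(Q)`
(`M = {s ↔ w}`; `RB.Club ⟺ 0 ≤ clubVal`), pinning `f` gives the exact two-point decomposition of
MINE-A.md §45 add. (b) in which the star term VANISHES (a pendant edge changes no event of `G − w`)
and the forced branch is the coarse form at `u` in `G − w`:

`clubVal_G(w) = p_f · clubVal_{G−w}(u) − R_f`, `R_f ≥ 0` the refinement loss of the coarse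
σ-algebra (it does not see the edge bit on the `{w ∉ C_s}` atom; its sign is BHK 1.3 for the
events `{b ∈ C_s}`, `{u ∈ C_s}`: avoiding `u` lowers the conditional probability of `b ∈ C_s`).

`club_pendant_le` is the inequality `clubVal_G(w) ≤ p_f · clubVal_{G−w}(u)` (the identity with
the explicit `R_f` is `RBRootEdge.mix_same`'s cleared difference). With the kernel theorem
`RB.Club_of_nbhd'` it explains the NEGATIVE of MINE-A.md §50 (d): at `w` pendant at a kernel vertex
`u`, `clubVal(w) = p_f · clubVal(u) − R_f` with `clubVal(u) ≥ 0` can still be negative (exact witness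
`−2.6·10⁻⁵`), so the kernel hypothesis of 2′RB-CLUB-K is sharp even for a single pendant edge.
-/

namespace Summit.Ventures.PercRepro2

namespace RBClubPendant

open scoped Classical

section Shift

variable {V : Type*} {E : Type*} [Fintype E] [DecidableEq E] [Fintype V] {R : Type*} [Field R]
  [LinearOrder R] [IsStrictOrderedRing R] (ends : E → Sym2 V) (s t : V)

/-- **Avoiding a vertex lowers the conditional probability of a cluster event** (BHK 1.3 for the
events `{b ∈ C_s}`, `{u ∈ C_s}`), cleared: `P(Q ∩ {s ↔ u}ᶜ ∩ bL) · P(Q) ≤ P(Q ∩ bL) · P(Q ∩ {s ↔ u}ᶜ)`. -/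
lemma avoid_shift {q : E → R} (hq : IsProbVec q) (u b : V) :
    prob q ((connEvent ends s t)ᶜ ∩ (connEvent ends s u)ᶜ ∩ connEvent ends b s) *
        prob q (connEvent ends s t)ᶜ ≤
      prob q ((connEvent ends s t)ᶜ ∩ connEvent ends b s) *
        prob q ((connEvent ends s t)ᶜ ∩ (connEvent ends s u)ᶜ) := by
  have key := bhk_same_cluster_events q hq ends s t (RBRoot.isUpperSet_mem b) (RBRoot.isUpperSet_mem u)
  rw [← RBRoot.connEvent_eq_clusterInEvent_right ends b s,
    ← RBRoot.connEvent_eq_clusterInEvent_right ends u s, RBClubRoot.connEvent_comm ends u s] at key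
  have e1 : connEvent ends b s ∩ (connEvent ends s t)ᶜ =
      (connEvent ends s t)ᶜ ∩ connEvent ends b s := Set.inter_comm _ _
  have e2 : connEvent ends s u ∩ (connEvent ends s t)ᶜ =
      (connEvent ends s t)ᶜ ∩ connEvent ends s u := Set.inter_comm _ _
  have e3 : connEvent ends b s ∩ connEvent ends s u ∩ (connEvent ends s t)ᶜ =
      (connEvent ends s t)ᶜ ∩ connEvent ends b s ∩ connEvent ends s u := by
    ext ω; simp only [Set.mem_inter_iff]; tauto
  rw [e1, e2, e3] at key
  have dA := prob_inter_add_prob_inter_compl q ((connEvent ends s t)ᶜ ∩ connEvent ends b s)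
    (connEvent ends s u)
  have dZ := prob_inter_add_prob_inter_compl q (connEvent ends s t)ᶜ (connEvent ends s u)
  have e4 : (connEvent ends s t)ᶜ ∩ (connEvent ends s u)ᶜ ∩ connEvent ends b s =
      (connEvent ends s t)ᶜ ∩ connEvent ends b s ∩ (connEvent ends s u)ᶜ := Set.inter_right_comm _ _ _
  rw [e4]
  have hA' : prob q ((connEvent ends s t)ᶜ ∩ connEvent ends b s ∩ (connEvent ends s u)ᶜ) *
      prob q (connEvent ends s t)ᶜ =
      prob q ((connEvent ends s t)ᶜ ∩ connEvent ends b s) * prob q (connEvent ends s t)ᶜ -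
      prob q ((connEvent ends s t)ᶜ ∩ connEvent ends b s ∩ connEvent ends s u) *
        prob q (connEvent ends s t)ᶜ := by
    rw [← dA]; ring
  have hZ' : prob q ((connEvent ends s t)ᶜ ∩ connEvent ends b s) *
      prob q ((connEvent ends s t)ᶜ ∩ (connEvent ends s u)ᶜ) =
      prob q ((connEvent ends s t)ᶜ ∩ connEvent ends b s) * prob q (connEvent ends s t)ᶜ -
      prob q ((connEvent ends s t)ᶜ ∩ connEvent ends b s) *
        prob q ((connEvent ends s t)ᶜ ∩ connEvent ends s u) := by
    rw [← dZ]; ring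
  linarith [key, hA', hZ']

end Shift

section Mixture

variable {R : Type*} [Field R] [LinearOrder R] [IsStrictOrderedRing R]

/-- **The pendant two-point step**: with the forced branch's coarse value `J + x₁y₁/n₁ − x₀y₀/n₀`
(at `u`), the isolated branch contributing the unconditioned masses, and both avoidance shifts of
the same sign, the coarse value of the pendant vertex is at most `q` times the value at `u`. -/
lemma pendant_mix {q J x0 x1 y0 y1 n0 n1 : R} (hq0 : 0 ≤ q) (hq1 : q ≤ 1)
    (hx0 : 0 ≤ x0) (hx0n : x0 ≤ n0) (hx1 : 0 ≤ x1) (hx1n : x1 ≤ n1) (hy0 : 0 ≤ y0) (hy0n : y0 ≤ n0)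
    (hy1 : 0 ≤ y1) (hy1n : y1 ≤ n1) (hAB : 0 ≤ (x1 * n0 - x0 * n1) * (y1 * n0 - y0 * n1)) :
    q * J + (q * x1 + (1 - q) * x0) * (q * y1 + (1 - q) * y0) / (q * n1 + (1 - q) * n0) -
        x0 * y0 / n0 ≤
      q * (J + x1 * y1 / n1 - x0 * y0 / n0) := by
  have hmix := RBRootEdge.mix_same hq0 hq1 hx0 hx0n hx1 hx1n hy0 hy0n hy1 hy1n hAB
  have e : q * (J + x1 * y1 / n1 - x0 * y0 / n0) =
      q * J + (q * (x1 * y1 / n1) + (1 - q) * (x0 * y0 / n0)) - x0 * y0 / n0 := by ring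
  rw [e]
  linarith [hmix]

end Mixture

section Main

variable {V : Type*} {E : Type*} [Fintype E] [DecidableEq E] [Fintype V] {R : Type*} [Field R]
  [LinearOrder R] [IsStrictOrderedRing R] (ends : E → Sym2 V) (s t w : V)

/-- **The coarse form at a pendant third vertex is at most `p_f` times the coarse form at its
neighbour in `G − w`** (`f = {w, u}` the only edge of nonzero weight at `w`): the exact defect is the
refinement loss `R_f ≥ 0` of the coarse σ-algebra. -/
theorem club_pendant_le {p : E → R} (hp : IsProbVec p) {f : E} {u o b : V}
    (hz : ∀ e, w ∈ ends e → e ≠ f → p e = 0) (hends : ends f = s(w, u)) (hws : s ≠ w) (hwt : t ≠ w)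
    (hwb : b ≠ w) (hwo : o ≠ w) (huw : u ≠ w) :
    prob p ((connEvent ends s t)ᶜ ∩ connEvent ends s w ∩ connEvent ends b s ∩ connEvent ends o s) +
        prob p ((connEvent ends s t)ᶜ ∩ (connEvent ends s w)ᶜ ∩ connEvent ends b s) *
            prob p ((connEvent ends s t)ᶜ ∩ (connEvent ends s w)ᶜ ∩ connEvent ends o s) /
          prob p ((connEvent ends s t)ᶜ ∩ (connEvent ends s w)ᶜ) -
        prob p ((connEvent ends s t)ᶜ ∩ connEvent ends b s) *
          prob p ((connEvent ends s t)ᶜ ∩ connEvent ends o s) / prob p (connEvent ends s t)ᶜ ≤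
      p f * (prob (Function.update p f 0)
          ((connEvent ends s t)ᶜ ∩ connEvent ends s u ∩ connEvent ends b s ∩ connEvent ends o s) +
        prob (Function.update p f 0)
            ((connEvent ends s t)ᶜ ∩ (connEvent ends s u)ᶜ ∩ connEvent ends b s) *
          prob (Function.update p f 0)
            ((connEvent ends s t)ᶜ ∩ (connEvent ends s u)ᶜ ∩ connEvent ends o s) /
          prob (Function.update p f 0) ((connEvent ends s t)ᶜ ∩ (connEvent ends s u)ᶜ) -
        prob (Function.update p f 0) ((connEvent ends s t)ᶜ ∩ connEvent ends b s) *
          prob (Function.update p f 0) ((connEvent ends s t)ᶜ ∩ connEvent ends o s) /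
          prob (Function.update p f 0) (connEvent ends s t)ᶜ) := by
  have hz' : ∀ e, w ∈ ends e ∧ e ≠ f → p e = 0 := fun e he => hz e he.1 he.2
  have hz0 : ∀ e, w ∈ ends e → Function.update p f 0 e = 0 := by
    intro e he
    by_cases h : e = f
    · subst h; exact Function.update_self _ _ _
    · rw [Function.update_of_ne h]; exact hz e he h
  have hp0 : IsProbVec (Function.update p f 0) := hp.update f le_rfl zero_le_one
  set Q := (connEvent ends s t)ᶜ with hQ
  set M := connEvent ends s w with hM
  set Mu := connEvent ends s u with hMu
  set bL := connEvent ends b s with hbL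
  set oL := connEvent ends o s with hoL
  -- leaf invariance: forcing `f` changes no event among vertices `≠ w`
  have inv : ∀ (S : Set (Config E)), (∀ ω : Config E, (∀ e, w ∈ ends e ∧ e ≠ f → ω e = false) →
      ∀ c' : Bool, (Function.update ω f c' ∈ S ↔ ω ∈ S)) →
      prob (Function.update p f 1) S = prob p S ∧ prob (Function.update p f 0) S = prob p S :=
    fun S hS => ⟨RBTwoMarkers.prob_leaf_update_of_zero ends w p hz' 1 (Or.inr rfl) S hS,
      RBTwoMarkers.prob_leaf_update_of_zero ends w p hz' 0 (Or.inl rfl) S hS⟩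
  have hQi : ∀ ω : Config E, (∀ e, w ∈ ends e ∧ e ≠ f → ω e = false) → ∀ c' : Bool,
      (Function.update ω f c' ∈ Q ↔ ω ∈ Q) := by
    intro ω hcl c'
    simp only [hQ, Set.mem_compl_iff, mem_connEvent]
    exact not_congr (RBTwoMarkers.conn_leaf_iff_of_closed ends w hends hcl hws hwt c')
  have hEi : ∀ (x y : V), x ≠ w → y ≠ w → ∀ ω : Config E,
      (∀ e, w ∈ ends e ∧ e ≠ f → ω e = false) → ∀ c' : Bool,
      (Function.update ω f c' ∈ connEvent ends x y ↔ ω ∈ connEvent ends x y) := by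
    intro x y hx hy ω hcl c'
    simp only [mem_connEvent]
    exact RBTwoMarkers.conn_leaf_iff_of_closed ends w hends hcl hx hy c'
  obtain ⟨Z1, Z0⟩ := inv Q hQi
  obtain ⟨B1, B0⟩ := inv (Q ∩ bL) fun ω hcl c' => by
    simp only [Set.mem_inter_iff]; exact and_congr (hQi ω hcl c') (hEi b s hwb hws ω hcl c')
  obtain ⟨O1, O0⟩ := inv (Q ∩ oL) fun ω hcl c' => by
    simp only [Set.mem_inter_iff]; exact and_congr (hQi ω hcl c') (hEi o s hwo hws ω hcl c')
  obtain ⟨J1, -⟩ := inv (Q ∩ Mu ∩ bL ∩ oL) fun ω hcl c' => by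
    simp only [Set.mem_inter_iff]
    exact and_congr (and_congr (and_congr (hQi ω hcl c') (hEi s u hws huw ω hcl c'))
      (hEi b s hwb hws ω hcl c')) (hEi o s hwo hws ω hcl c')
  obtain ⟨X1, -⟩ := inv (Q ∩ Muᶜ ∩ bL) fun ω hcl c' => by
    simp only [Set.mem_inter_iff, Set.mem_compl_iff]
    exact and_congr (and_congr (hQi ω hcl c') (not_congr (hEi s u hws huw ω hcl c')))
      (hEi b s hwb hws ω hcl c')
  obtain ⟨Y1, -⟩ := inv (Q ∩ Muᶜ ∩ oL) fun ω hcl c' => by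
    simp only [Set.mem_inter_iff, Set.mem_compl_iff]
    exact and_congr (and_congr (hQi ω hcl c') (not_congr (hEi s u hws huw ω hcl c')))
      (hEi o s hwo hws ω hcl c')
  obtain ⟨N1, -⟩ := inv (Q ∩ Muᶜ) fun ω hcl c' => by
    simp only [Set.mem_inter_iff, Set.mem_compl_iff]
    exact and_congr (hQi ω hcl c') (not_congr (hEi s u hws huw ω hcl c'))
  -- the forced branch: `{s ↔ w}` is `{s ↔ u}`
  have e10 : Q ∩ M ∩ bL ∩ oL = Q ∩ M ∩ (bL ∩ oL) := Set.inter_assoc _ _ _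
  have e10' : Q ∩ Mu ∩ (bL ∩ oL) = Q ∩ Mu ∩ bL ∩ oL := (Set.inter_assoc _ _ _).symm
  have F1 : prob (Function.update p f 1) (Q ∩ M ∩ bL ∩ oL) =
      prob (Function.update p f 0) (Q ∩ Mu ∩ bL ∩ oL) := by
    rw [e10, RBClubTwoMarkers.prob_update_one_inter_conn_eq ends s w p hends,
      RBClubRoot.connEvent_comm ends u s, e10', J1]
    exact (inv (Q ∩ Mu ∩ bL ∩ oL) fun ω hcl c' => by
      simp only [Set.mem_inter_iff]
      exact and_congr (and_congr (and_congr (hQi ω hcl c') (hEi s u hws huw ω hcl c'))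
        (hEi b s hwb hws ω hcl c')) (hEi o s hwo hws ω hcl c')).2.symm
  have FX : prob (Function.update p f 1) (Q ∩ Mᶜ ∩ bL) =
      prob (Function.update p f 0) (Q ∩ Muᶜ ∩ bL) := by
    rw [RBClubTwoMarkers.prob_update_one_inter_compl_conn_eq ends s w p hends,
      RBClubRoot.connEvent_comm ends u s, X1]
    exact (inv (Q ∩ Muᶜ ∩ bL) fun ω hcl c' => by
      simp only [Set.mem_inter_iff, Set.mem_compl_iff]
      exact and_congr (and_congr (hQi ω hcl c') (not_congr (hEi s u hws huw ω hcl c')))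
        (hEi b s hwb hws ω hcl c')).2.symm
  have FY : prob (Function.update p f 1) (Q ∩ Mᶜ ∩ oL) =
      prob (Function.update p f 0) (Q ∩ Muᶜ ∩ oL) := by
    rw [RBClubTwoMarkers.prob_update_one_inter_compl_conn_eq ends s w p hends,
      RBClubRoot.connEvent_comm ends u s, Y1]
    exact (inv (Q ∩ Muᶜ ∩ oL) fun ω hcl c' => by
      simp only [Set.mem_inter_iff, Set.mem_compl_iff]
      exact and_congr (and_congr (hQi ω hcl c') (not_congr (hEi s u hws huw ω hcl c')))
        (hEi o s hwo hws ω hcl c')).2.symm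
  have FN : prob (Function.update p f 1) (Q ∩ Mᶜ) = prob (Function.update p f 0) (Q ∩ Muᶜ) := by
    have h := RBClubTwoMarkers.prob_update_one_inter_compl_conn_eq ends s w p hends Q Set.univ
    rw [Set.inter_univ, Set.inter_univ, RBClubRoot.connEvent_comm ends u s] at h
    rw [h, N1]
    exact (inv (Q ∩ Muᶜ) fun ω hcl c' => by
      simp only [Set.mem_inter_iff, Set.mem_compl_iff]
      exact and_congr (hQi ω hcl c') (not_congr (hEi s u hws huw ω hcl c'))).2.symm
  -- the isolated branch: `{s ↔ w}` is null
  have e00 : Q ∩ M ∩ bL ∩ oL = Q ∩ bL ∩ oL ∩ M := by ac_rfl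
  have I0 : prob (Function.update p f 0) (Q ∩ M ∩ bL ∩ oL) = 0 := by
    rw [e00]; exact RBClubTwoMarkers.prob_inter_conn_eq_zero_of_closed ends s w _ hz0 hws _
  have IX : prob (Function.update p f 0) (Q ∩ Mᶜ ∩ bL) = prob (Function.update p f 0) (Q ∩ bL) := by
    rw [Set.inter_right_comm, RBClubTwoMarkers.prob_inter_compl_conn_eq_of_closed ends s w _ hz0 hws]
  have IY : prob (Function.update p f 0) (Q ∩ Mᶜ ∩ oL) = prob (Function.update p f 0) (Q ∩ oL) := by
    rw [Set.inter_right_comm, RBClubTwoMarkers.prob_inter_compl_conn_eq_of_closed ends s w _ hz0 hws]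
  have IN : prob (Function.update p f 0) (Q ∩ Mᶜ) = prob (Function.update p f 0) Q :=
    RBClubTwoMarkers.prob_inter_compl_conn_eq_of_closed ends s w _ hz0 hws Q
  -- the seven masses of `p`
  have h1 := prob_eq_pin p (Q ∩ M ∩ bL ∩ oL) f
  have h2 := prob_eq_pin p (Q ∩ Mᶜ ∩ bL) f
  have h3 := prob_eq_pin p (Q ∩ Mᶜ ∩ oL) f
  have h4 := prob_eq_pin p (Q ∩ Mᶜ) f
  rw [F1, I0, mul_zero, add_zero] at h1
  rw [FX, IX] at h2
  rw [FY, IY] at h3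
  rw [FN, IN] at h4
  rw [h1, h2, h3, h4, ← B0, ← O0, ← Z0]
  -- the avoidance shifts are both `≤ 0`
  have hAB : 0 ≤ (prob (Function.update p f 0) (Q ∩ Muᶜ ∩ bL) * prob (Function.update p f 0) Q -
      prob (Function.update p f 0) (Q ∩ bL) * prob (Function.update p f 0) (Q ∩ Muᶜ)) *
      (prob (Function.update p f 0) (Q ∩ Muᶜ ∩ oL) * prob (Function.update p f 0) Q -
      prob (Function.update p f 0) (Q ∩ oL) * prob (Function.update p f 0) (Q ∩ Muᶜ)) :=
    mul_nonneg_of_nonpos_of_nonpos (sub_nonpos.2 (avoid_shift ends s t hp0 u b))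
      (sub_nonpos.2 (avoid_shift ends s t hp0 u o))
  exact pendant_mix (hp.nonneg f) (hp.le_one f) (prob_nonneg hp0 _)
    (prob_mono hp0 Set.inter_subset_left) (prob_nonneg hp0 _)
    (prob_mono hp0 Set.inter_subset_left) (prob_nonneg hp0 _)
    (prob_mono hp0 Set.inter_subset_left) (prob_nonneg hp0 _)
    (prob_mono hp0 Set.inter_subset_left) hAB

end Main

end RBClubPendant

end Summit.Ventures.PercRepro2
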